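import Literature.NumberTheory.GaloisRepresentations.KummerTwoTorsion
import Literature.NumberTheory.GaloisRepresentations.ConjugationDescent
import Literature.NumberTheory.GaloisRepresentations.ContinuousH1TrivialAction
import HarnessLib

/-!
# The continuous Bockstein isomorphism `δ₁ : H¹(G, M₃) ⥲ H²(G, M₁)` for a uniquely divisible
# middle term, `H²(G, ℤ) ≅ Hom_cont(G, ℚ/ℤ)`, and `H²(Ẑ, ℤ) ≅ ℚ/ℤ` by evaluation at a
# topological generator

Topic `NumberTheory/GaloisRepresentations`; namespace `Literature.NumberTheory.GaloisRepresentations`.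
Classical Galois cohomology on Mathlib's continuous cohomology, over the tree's explicit cocycles
(`ContinuousH1`, `ContinuousH2`), short exact sequences of discrete modules (`IsSES`,
`DiscreteCochains`) and connecting map `IsSES.δ₁` (`ContinuousCohomologyConnecting`).  No named
fact; the definitions are the equivalences themselves (with bodies).

For a profinite group `G`:

* §1 `exists_nsmul_one_eq_zero` — **`H¹(G, X)` is torsion** for `G` compact and `X` a discrete
  topological `G`-module: a continuous crossed homomorphism vanishes on an open subgroup `N`
  (its zero locus `oneCocycleKer`), and `cor ∘ res = (G : N)` (the tree's
  `cores_resSubgroup`) [Serre, *Galois Cohomology*, I §2.4 Prop. 9]; the degree-`2` twin is the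
  tree's `exists_nsmul_two_eq_zero` (`KummerTwoTorsion`).
* §2 `subsingleton_continuousCohomology_one/two_of_bijective_smul` — **`Hⁿ(G, M) = 0` (`n = 1, 2`)
  for a uniquely divisible discrete `G`-module `M`** (torsion, and multiplication by `n` is
  injective on `Hⁿ` when it is bijective on `M`: the tree's `exists_inverse_hom`,
  `eq_zero_of_smul_eq_zero_one/two`) [Serre, *Local Fields*, XIII §1, "`ℚ` has trivial
  cohomology"].
* §3 `IsSES.δ₁_bijective_of_bijective_smul`, `IsSES.δ₁Equiv` — the **Bockstein isomorphism**: for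
  a short exact sequence `0 → M₁ → M₂ → M₃ → 0` of discrete `G`-modules with `M₂` uniquely
  divisible, the connecting map `δ₁ : H¹(G, M₃) → H²(G, M₁)` is bijective (from the tree's
  `δ₁_injective/surjective_of_subsingleton`).  The case `0 → ℤ → ℚ → ℚ/ℤ → 0` with trivial
  action is `H²(G, ℤ) ≅ H¹(G, ℚ/ℤ)` [Serre, *Local Fields*, XIII §3; Cassels–Fröhlich VI §1.1].
* §4 `contOneCocyclesEquivOfTrivial` — for a TRIVIAL action, `Z¹_cont(G, X) = Hom_cont(G, X) ⥲
  H¹(G, X)` (the tree's `oneCocycleClass_injective_of_trivial` + `oneCocycleClass_surjective`,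
  packaged as a linear equivalence); `IsSES.H2EquivContOneCocycles` — **`H²(G, M₁) ≅
  Hom_cont(G, M₃)`** ("`H²(G, ℤ) ≅ Hom(G, ℚ/ℤ) = G^∨`").
* §5 `contOneCocycles.evalₗ`, `contOneCocyclesEquivOfDenseZpowers` — **evaluation at a topological
  generator**: if `γ` generates a dense cyclic subgroup of the profinite group `G` and `G` has an
  open subgroup of every positive index (i.e. `G ≅ Ẑ`; these are exactly the two fields of the
  abc-iut cell's predicate `FundamentalExtension.IsFreeProcyclic`, which this trunk file does not
  import), then `φ ↦ φ(γ)` is an isomorphism `Hom_cont(G, X) ⥲ X` onto any discrete TORSION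
  group `X` ("`Hom(Ẑ, ℚ/ℤ) → ℚ/ℤ`, `φ ↦ φ(F)`"); and the assembly `IsSES.H2EquivOfDenseZpowers` —
  **`H²(G, M₁) ≅ M₃` for `G ≅ Ẑ`, `[c] ↦ (δ₁⁻¹ [c])(γ)`** — i.e. `H²(Ẑ, ℤ) ≅ ℚ/ℤ`, the last map
  of the invariant `inv_K : Br(K) → ℚ/ℤ` of local class field theory.
* §6 `IsSES.ofTrivial` — constructor of the short exact sequence of TRIVIAL discrete modules
  attached to an exact triple of additive homomorphisms `M₁ ↪ M₂ ↠ M₃` (so that consumers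
  instantiate §3–§5 with their own discrete models of `ℤ ⊆ ℚ ↠ ℚ/ℤ`).

Consumers (abc-iut cell, by name): sub-DAG [AbsTopIII] Prop. 3.2 (i) row P32.i.L05
«`H²(Ẑ, ℤ) ⥲ ℚ/ℤ`» (field `Prop32iChain.toQmodZ` of `MonoidKummerMapsSub.lean`), and sub-DAG
[AbsAnab] Prop. 1.2.1 (vii) rows L04/L05′ («`δ : H¹(G_K/I_K, ℚ/ℤ) ⥲ H²(G_K/I_K, ℤ)`», «evaluation
at the Frobenius generator»).  Honest framing: textbook material (Serre); nothing here bears on abc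
or takes a side on [IUTchIII] Cor. 3.12.

## References
* J.-P. Serre, *Corps locaux* (1968) / *Local Fields* (1979), XIII §1 (cohomological triviality of
  `ℚ`, `δ : H¹(ℚ/ℤ) ⥲ H²(ℤ)`), XIII §3 (the invariant map via `H²(Ẑ, ℤ) ≅ ℚ/ℤ`). [SerreLocalFields1979]
* J.-P. Serre, *Cohomologie galoisienne* / *Galois Cohomology* (1997), I §2.2 Prop. 8, I §2.3,
  I §2.4 Prop. 9 (`Cor ∘ Res`). [SerreGaloisCohomology1997]
* J. W. S. Cassels, A. Fröhlich (eds.), *Algebraic Number Theory* (1967), Ch. VI (Serre, Local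
  class field theory) §1.1. [CasselsFrohlichANT1967]
-/

noncomputable section

open CategoryTheory Function

universe u v

namespace Literature.NumberTheory.GaloisRepresentations

open _root_.TopRep _root_.ContRepresentation _root_.ContinuousCohomology _root_.Topology

/-! ### §1 `H¹(G, X)` is torsion for `G` compact and `X` discrete -/

section TorsionOne

variable {R : Type u} [CommRing R] [TopologicalSpace R]
variable {G : Type v} [Group G] [TopologicalSpace G] [IsTopologicalGroup G]
variable (X : TopRep.{v} R G)

variable {X} in
/-- The **zero locus** `{g | φ(g) = 0}` of a continuous crossed homomorphism `φ : G → X`: a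
subgroup (`φ(gh) = φ(g) + g φ(h)`, `φ(g⁻¹) = -g⁻¹ φ(g)`), open when `X` is discrete.
[cite: SerreGaloisCohomology1997, I §2.2 Prop. 8] -/
def oneCocycleKer (φ : contOneCocycles X) : Subgroup G where
  carrier := {g | φ.1 g = 0}
  one_mem' := contOneCocycles.apply_one φ
  mul_mem' {a b} ha hb := by
    change φ.1 a = 0 at ha
    change φ.1 b = 0 at hb
    change φ.1 (a * b) = 0
    rw [φ.2 a b, ha, hb, map_zero, add_zero]
  inv_mem' {a} ha := by
    change φ.1 a = 0 at ha
    change φ.1 a⁻¹ = 0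
    rw [contOneCocycles.apply_inv, ha, map_zero, neg_zero]

omit [IsTopologicalGroup G] in
variable {X} in
/-- Membership in the zero locus. [cite: SerreGaloisCohomology1997, I §2.2 Prop. 8] -/
@[simp] theorem mem_oneCocycleKer_iff (φ : contOneCocycles X) (g : G) :
    g ∈ oneCocycleKer φ ↔ φ.1 g = 0 :=
  Iff.rfl

omit [IsTopologicalGroup G] in
variable {X} in
/-- For a discrete module the zero locus of a continuous crossed homomorphism is open (a class of
`H¹` "dies on a small open subgroup"). [cite: SerreGaloisCohomology1997, I §2.2 Prop. 8] -/
theorem isOpen_oneCocycleKer [DiscreteTopology X] (φ : contOneCocycles X) :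
    IsOpen (oneCocycleKer φ : Set G) :=
  (isOpen_discrete ({0} : Set X)).preimage φ.1.continuous

variable {X} in
/-- A crossed homomorphism restricts to zero on its zero locus: `res [φ] = 0` in
`H¹(N_φ, X)`. [cite: SerreGaloisCohomology1997, I §2.4] -/
theorem resSubgroup_oneCocycleKer_oneCocycleClass (φ : contOneCocycles X) :
    resSubgroup X (oneCocycleKer φ) 1 (oneCocycleClass X φ) = 0 := by
  rw [resSubgroup_oneCocycleClass]
  convert oneCocycleClass_zero (subgroupRep X (oneCocycleKer φ)) using 2
  refine Subtype.ext (ContinuousMap.ext fun n => ?_)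
  rw [resSubgroup_pullback_apply]
  exact n.2

/-- **`H¹(G, X)` is a torsion group** for `G` compact and `X` a discrete topological `G`-module:
every class is killed by the index of the (open) zero locus of a representing crossed
homomorphism, by `cor ∘ res = (G : N)`. [cite: SerreGaloisCohomology1997, I §2.4 Prop. 9] -/
theorem exists_nsmul_one_eq_zero [CompactSpace G] [DiscreteTopology X]
    (η : continuousCohomology 1 X) : ∃ n : ℕ, 0 < n ∧ n • η = 0 := by
  obtain ⟨φ, rfl⟩ := oneCocycleClass_surjective X η
  have hN : IsOpen (oneCocycleKer φ : Set G) := isOpen_oneCocycleKer φ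
  haveI : Finite (G ⧸ oneCocycleKer φ) := Subgroup.quotient_finite_of_isOpen _ hN
  letI : Fintype (G ⧸ oneCocycleKer φ) := Fintype.ofFinite _
  refine ⟨(oneCocycleKer φ).index, Nat.pos_of_ne_zero (oneCocycleKer φ).index_ne_zero_of_finite, ?_⟩
  have h := cores_resSubgroup X (oneCocycleKer φ) hN (oneCocycleClass X φ)
  rw [resSubgroup_oneCocycleKer_oneCocycleClass, map_zero, Nat.cast_smul_eq_nsmul] at h
  exact h.symm

/-- Every class of `H¹(G, X)` has finite order (`G` compact, `X` discrete).
[cite: SerreGaloisCohomology1997, I §2.4 Prop. 9] -/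
theorem isOfFinAddOrder_one [CompactSpace G] [DiscreteTopology X] (η : continuousCohomology 1 X) :
    IsOfFinAddOrder η := by
  obtain ⟨n, hn, h⟩ := exists_nsmul_one_eq_zero X η
  exact isOfFinAddOrder_iff_nsmul_eq_zero.mpr ⟨n, hn, h⟩

end TorsionOne

/-! ### §2 Uniquely divisible discrete coefficients have trivial `H¹` and `H²` -/

section Divisible

variable {G : Type u} [Group G] [TopologicalSpace G] [IsTopologicalGroup G] [CompactSpace G]
variable {M : Type u} [AddCommGroup M] [TopologicalSpace M] [DiscreteTopology M]

/-- **`H¹(G, M) = 0` for a uniquely divisible discrete module over a compact group** (every class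
is torsion, and multiplication by `n ≥ 1` is injective on `H¹` as it is bijective on `M`).
[cite: SerreLocalFields1979, XIII §1] -/
theorem subsingleton_continuousCohomology_one_of_bijective_smul (ρ : ContinuousRep G ℤ M)
    (hdiv : ∀ n : ℕ, 0 < n → Bijective fun m : M => (n : ℤ) • m) :
    Subsingleton (continuousCohomology 1 ρ.toTopRep) := by
  refine ⟨fun x y => ?_⟩
  rw [← sub_eq_zero]
  obtain ⟨n, hn, h⟩ := exists_nsmul_one_eq_zero ρ.toTopRep (x - y)
  obtain ⟨e, he, -⟩ := exists_inverse_hom ρ (n : ℤ) (hdiv n hn)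
  exact eq_zero_of_smul_eq_zero_one ρ.toTopRep (n : ℤ) e he _ (by rw [Nat.cast_smul_eq_nsmul]; exact h)

variable [T2Space G] [TotallyDisconnectedSpace G]

/-- **`H²(G, M) = 0` for a uniquely divisible discrete module over a profinite group** (the tree's
`exists_nsmul_two_eq_zero`: `H²` is torsion; multiplication by `n ≥ 1` is injective on `H²`).
[cite: SerreLocalFields1979, XIII §1] -/
theorem subsingleton_continuousCohomology_two_of_bijective_smul (ρ : ContinuousRep G ℤ M)
    (hdiv : ∀ n : ℕ, 0 < n → Bijective fun m : M => (n : ℤ) • m) :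
    Subsingleton (continuousCohomology 2 ρ.toTopRep) := by
  refine ⟨fun x y => ?_⟩
  rw [← sub_eq_zero]
  obtain ⟨n, hn, h⟩ := exists_nsmul_two_eq_zero ρ (x - y)
  obtain ⟨e, he, -⟩ := exists_inverse_hom ρ (n : ℤ) (hdiv n hn)
  exact eq_zero_of_smul_eq_zero_two ρ.toTopRep (n : ℤ) e he _ (by rw [Nat.cast_smul_eq_nsmul]; exact h)

end Divisible

/-! ### §3 The Bockstein isomorphism -/

namespace IsSES

variable {G : Type u} [Group G] [TopologicalSpace G] [IsTopologicalGroup G] [CompactSpace G]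
  [T2Space G] [TotallyDisconnectedSpace G]
variable {M₁ : Type u} [AddCommGroup M₁] [TopologicalSpace M₁] [DiscreteTopology M₁]
variable {M₂ : Type u} [AddCommGroup M₂] [TopologicalSpace M₂] [DiscreteTopology M₂]
variable {M₃ : Type u} [AddCommGroup M₃] [TopologicalSpace M₃] [DiscreteTopology M₃]
variable {ρ₁ : ContinuousRep G ℤ M₁} {ρ₂ : ContinuousRep G ℤ M₂} {ρ₃ : ContinuousRep G ℤ M₃}
variable {f : ρ₁.toTopRep ⟶ ρ₂.toTopRep} {g : ρ₂.toTopRep ⟶ ρ₃.toTopRep}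

/-- **The Bockstein isomorphism.** For a short exact sequence `0 → M₁ → M₂ → M₃ → 0` of discrete
modules over a profinite group with `M₂` uniquely divisible, the connecting homomorphism
`δ₁ : H¹(G, M₃) → H²(G, M₁)` is bijective (`H¹(G, M₂) = 0` gives injectivity, `H²(G, M₂) = 0`
surjectivity).  Typical case: `0 → ℤ → ℚ → ℚ/ℤ → 0` with trivial action,
`δ : H¹(G, ℚ/ℤ) ⥲ H²(G, ℤ)`. [cite: SerreLocalFields1979, XIII §1] -/
theorem δ₁_bijective_of_bijective_smul (h : IsSES f g)
    (hdiv : ∀ n : ℕ, 0 < n → Bijective fun m : M₂ => (n : ℤ) • m) : Bijective h.δ₁ := by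
  haveI := subsingleton_continuousCohomology_one_of_bijective_smul ρ₂ hdiv
  haveI := subsingleton_continuousCohomology_two_of_bijective_smul ρ₂ hdiv
  exact ⟨δ₁_injective_of_subsingleton h, δ₁_surjective_of_subsingleton h⟩

/-- The Bockstein isomorphism `δ₁ : H¹(G, M₃) ⥲ H²(G, M₁)` as a linear equivalence (`M₂` uniquely
divisible, `G` profinite). [cite: SerreLocalFields1979, XIII §1] -/
def δ₁Equiv (h : IsSES f g) (hdiv : ∀ n : ℕ, 0 < n → Bijective fun m : M₂ => (n : ℤ) • m) :
    continuousCohomology 1 ρ₃.toTopRep ≃ₗ[ℤ] continuousCohomology 2 ρ₁.toTopRep :=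
  LinearEquiv.ofBijective h.δ₁ (h.δ₁_bijective_of_bijective_smul hdiv)

/-- `δ₁Equiv` is `δ₁`. [cite: SerreLocalFields1979, XIII §1] -/
@[simp] theorem δ₁Equiv_apply (h : IsSES f g)
    (hdiv : ∀ n : ℕ, 0 < n → Bijective fun m : M₂ => (n : ℤ) • m)
    (x : continuousCohomology 1 ρ₃.toTopRep) : h.δ₁Equiv hdiv x = h.δ₁ x :=
  rfl

/-- `δ₁ (δ₁Equiv⁻¹ z) = z`. [cite: SerreLocalFields1979, XIII §1] -/
@[simp] theorem δ₁_δ₁Equiv_symm_apply (h : IsSES f g)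
    (hdiv : ∀ n : ℕ, 0 < n → Bijective fun m : M₂ => (n : ℤ) • m)
    (z : continuousCohomology 2 ρ₁.toTopRep) : h.δ₁ ((h.δ₁Equiv hdiv).symm z) = z :=
  (h.δ₁Equiv hdiv).apply_symm_apply z

end IsSES

/-! ### §4 Trivial action: `Hom_cont(G, X) = Z¹_cont(G, X) ⥲ H¹(G, X)` -/

section TrivialAction

variable {R : Type u} [CommRing R] [TopologicalSpace R]
variable {G : Type v} [Group G] [TopologicalSpace G] [IsTopologicalGroup G]
variable (X : TopRep.{v} R G)

/-- **`Z¹_cont(G, X) ⥲ H¹(G, X)` for a trivial action** (`[·]` is injective because every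
coboundary vanishes, and surjective always); here `Z¹_cont(G, X) = contOneCocycles X` is the module
of continuous homomorphisms `G → X` (`contOneCocycles.apply_mul_of_trivial`), so this is
"`H¹(G, A) = Hom(G, A)` for trivial `A`". [cite: SerreGaloisCohomology1997, I §2.3] -/
def contOneCocyclesEquivOfTrivial (htriv : ∀ (g : G) (x : X), X.ρ g x = x) :
    contOneCocycles X ≃ₗ[R] continuousCohomology 1 X :=
  LinearEquiv.ofBijective (oneCocycleClassₗ X)
    ⟨oneCocycleClass_injective_of_trivial X htriv, oneCocycleClass_surjective X⟩

/-- `contOneCocyclesEquivOfTrivial φ = [φ]`. [cite: SerreGaloisCohomology1997, I §2.3] -/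
@[simp] theorem contOneCocyclesEquivOfTrivial_apply (htriv : ∀ (g : G) (x : X), X.ρ g x = x)
    (φ : contOneCocycles X) : contOneCocyclesEquivOfTrivial X htriv φ = oneCocycleClass X φ :=
  rfl

/-- `[(contOneCocyclesEquivOfTrivial)⁻¹ η] = η`. [cite: SerreGaloisCohomology1997, I §2.3] -/
@[simp] theorem oneCocycleClass_contOneCocyclesEquivOfTrivial_symm_apply
    (htriv : ∀ (g : G) (x : X), X.ρ g x = x) (η : continuousCohomology 1 X) :
    oneCocycleClass X ((contOneCocyclesEquivOfTrivial X htriv).symm η) = η :=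
  (contOneCocyclesEquivOfTrivial X htriv).apply_symm_apply η

end TrivialAction

namespace IsSES

variable {G : Type u} [Group G] [TopologicalSpace G] [IsTopologicalGroup G] [CompactSpace G]
  [T2Space G] [TotallyDisconnectedSpace G]
variable {M₁ : Type u} [AddCommGroup M₁] [TopologicalSpace M₁] [DiscreteTopology M₁]
variable {M₂ : Type u} [AddCommGroup M₂] [TopologicalSpace M₂] [DiscreteTopology M₂]
variable {M₃ : Type u} [AddCommGroup M₃] [TopologicalSpace M₃] [DiscreteTopology M₃]
variable {ρ₁ : ContinuousRep G ℤ M₁} {ρ₂ : ContinuousRep G ℤ M₂} {ρ₃ : ContinuousRep G ℤ M₃}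
variable {f : ρ₁.toTopRep ⟶ ρ₂.toTopRep} {g : ρ₂.toTopRep ⟶ ρ₃.toTopRep}

/-- **`H²(G, M₁) ≅ Hom_cont(G, M₃)`** for a short exact sequence `0 → M₁ → M₂ → M₃ → 0` of
discrete modules over a profinite group with `M₂` uniquely divisible and `M₃` carrying the TRIVIAL
action: the composite `Z¹_cont(G, M₃) ⥲ H¹(G, M₃) ⥲ H²(G, M₁)` of §4 and the Bockstein
isomorphism — "`H²(G, ℤ) ≅ Hom(G, ℚ/ℤ) = G^∨`". [cite: SerreLocalFields1979, XIII §1] -/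
def H2EquivContOneCocycles (h : IsSES f g)
    (hdiv : ∀ n : ℕ, 0 < n → Bijective fun m : M₂ => (n : ℤ) • m)
    (htriv : ∀ (σ : G) (x : M₃), ρ₃ σ x = x) :
    continuousCohomology 2 ρ₁.toTopRep ≃ₗ[ℤ] contOneCocycles ρ₃.toTopRep :=
  (h.δ₁Equiv hdiv).symm ≪≫ₗ (contOneCocyclesEquivOfTrivial ρ₃.toTopRep htriv).symm

/-- `H2EquivContOneCocycles⁻¹ φ = δ₁ [φ]`: the class attached to a continuous homomorphism
`φ : G → M₃` is the Bockstein of `[φ]`. [cite: SerreLocalFields1979, XIII §1] -/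
@[simp] theorem H2EquivContOneCocycles_symm_apply (h : IsSES f g)
    (hdiv : ∀ n : ℕ, 0 < n → Bijective fun m : M₂ => (n : ℤ) • m)
    (htriv : ∀ (σ : G) (x : M₃), ρ₃ σ x = x) (φ : contOneCocycles ρ₃.toTopRep) :
    (h.H2EquivContOneCocycles hdiv htriv).symm φ = h.δ₁ (oneCocycleClass _ φ) :=
  rfl

/-- `δ₁ [H2EquivContOneCocycles z] = z`. [cite: SerreLocalFields1979, XIII §1] -/
@[simp] theorem δ₁_oneCocycleClass_H2EquivContOneCocycles_apply (h : IsSES f g)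
    (hdiv : ∀ n : ℕ, 0 < n → Bijective fun m : M₂ => (n : ℤ) • m)
    (htriv : ∀ (σ : G) (x : M₃), ρ₃ σ x = x) (z : continuousCohomology 2 ρ₁.toTopRep) :
    h.δ₁ (oneCocycleClass _ (h.H2EquivContOneCocycles hdiv htriv z)) = z := by
  rw [← H2EquivContOneCocycles_symm_apply h hdiv htriv, LinearEquiv.symm_apply_apply]

end IsSES

/-! ### §5 Evaluation at a topological generator: `Hom_cont(Ẑ, ℚ/ℤ) ⥲ ℚ/ℤ` -/

section Eval

variable {R : Type u} [CommRing R] [TopologicalSpace R]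
variable {G : Type v} [Group G] [TopologicalSpace G] [IsTopologicalGroup G]
variable (X : TopRep.{v} R G)

/-- Evaluation of continuous crossed homomorphisms at an element `γ ∈ G`, `φ ↦ φ(γ)` (linear).
[cite: SerreLocalFields1979, XIII §3] -/
def contOneCocycles.evalₗ (γ : G) : contOneCocycles X →ₗ[R] X where
  toFun φ := φ.1 γ
  map_add' _ _ := rfl
  map_smul' _ _ := rfl

omit [IsTopologicalGroup G] in
/-- Unfolding `evalₗ`: `evalₗ γ φ = φ(γ)`. [cite: SerreLocalFields1979, XIII §3] -/
@[simp] theorem contOneCocycles.evalₗ_apply (γ : G) (φ : contOneCocycles X) :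
    contOneCocycles.evalₗ X γ φ = φ.1 γ :=
  rfl

omit [IsTopologicalGroup G] in
variable {X} in
/-- For a trivial action, `φ(γ^k) = k • φ(γ)` (a crossed homomorphism for a trivial action is a
homomorphism). [cite: SerreGaloisCohomology1997, I §2.3] -/
theorem contOneCocycles.apply_zpow_of_trivial (htriv : ∀ (g : G) (x : X), X.ρ g x = x)
    (φ : contOneCocycles X) (γ : G) (k : ℤ) : φ.1 (γ ^ k) = k • φ.1 γ := by
  -- the underlying homomorphism `G → X`
  let ψ : G →* Multiplicative X :=
    { toFun := fun g => Multiplicative.ofAdd (φ.1 g)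
      map_one' := by rw [contOneCocycles.apply_one]; rfl
      map_mul' := fun a b => by
        rw [contOneCocycles.apply_mul_of_trivial htriv]; rfl }
  have h := map_zpow ψ γ k
  exact Multiplicative.ofAdd.injective (by simpa [ψ] using h)

omit [IsTopologicalGroup G] in
variable {X} in
/-- **Evaluation at a topological generator is injective** on continuous homomorphisms into a
discrete module (trivial action): `φ(γ) = 0` forces `φ = 0` on the dense subgroup `γ^ℤ`, hence
everywhere. [cite: SerreLocalFields1979, XIII §3] -/
theorem contOneCocycles.evalₗ_injective_of_dense [DiscreteTopology X]
    (htriv : ∀ (g : G) (x : X), X.ρ g x = x) {γ : G}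
    (hγ : Dense (Subgroup.zpowers γ : Set G)) : Injective (contOneCocycles.evalₗ X γ) := by
  intro φ ψ h
  rw [← sub_eq_zero] at h ⊢
  rw [← map_sub] at h
  set χ := φ - ψ
  change χ.1 γ = 0 at h
  have hcl : IsClosed {g : G | χ.1 g = 0} := (isClosed_discrete ({0} : Set X)).preimage χ.1.continuous
  have hsub : (Subgroup.zpowers γ : Set G) ⊆ {g : G | χ.1 g = 0} := by
    rintro g ⟨k, rfl⟩
    change χ.1 (γ ^ k) = 0
    rw [contOneCocycles.apply_zpow_of_trivial htriv, h, smul_zero]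
  have hall : ∀ g : G, χ.1 g = 0 := fun g => by
    have : g ∈ closure (Subgroup.zpowers γ : Set G) := hγ g
    rw [← hcl.closure_subset_iff] at hsub
    exact hsub this
  exact Subtype.ext (ContinuousMap.ext hall)

variable [CompactSpace G] [TotallyDisconnectedSpace G]

variable {X} in
/-- **Evaluation at a topological generator hits every torsion element**, when `G` is profinite
with an open subgroup of every positive index (`G ≅ Ẑ`): for `x` of order `n`, take an open
NORMAL subgroup `N` inside the open subgroup of index `n`; `G/N` is finite cyclic generated by
the image `γ̄` of `γ`, of order `(G : N)` divisible by `n`, and `γ̄ ↦ x` defines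
`G ↠ G/N → X`. [cite: SerreLocalFields1979, XIII §3] -/
theorem contOneCocycles.exists_evalₗ_eq [DiscreteTopology X]
    (htriv : ∀ (g : G) (x : X), X.ρ g x = x) {γ : G}
    (hγ : Dense (Subgroup.zpowers γ : Set G))
    (hidx : ∀ n : ℕ, 0 < n → ∃ H : Subgroup G, IsOpen (H : Set G) ∧ H.index = n)
    (x : X) (hx : IsOfFinAddOrder x) :
    ∃ φ : contOneCocycles X, contOneCocycles.evalₗ X γ φ = x := by
  classical
  -- an open normal subgroup `N` of index divisible by the order `n` of `x`
  obtain ⟨U, hUo, hUi⟩ := hidx (addOrderOf x) hx.addOrderOf_pos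
  obtain ⟨N, hNU⟩ := ProfiniteGrp.exist_openNormalSubgroup_sub_open_nhds_of_one hUo U.one_mem
  have hNU' : (N : Subgroup G) ≤ U := fun g hg => hNU hg
  have hdvd : addOrderOf x ∣ (N : Subgroup G).index := hUi ▸ Subgroup.index_dvd_of_le hNU'
  -- the finite discrete quotient `Q = G / N`, generated by the image of `γ`
  haveI : DiscreteTopology (G ⧸ (N : Subgroup G)) := QuotientGroup.discreteTopology N.isOpen'
  set γbar : G ⧸ (N : Subgroup G) := (γ : G ⧸ (N : Subgroup G)) with hγbar
  have hdenseQ : Dense (Subgroup.zpowers γbar : Set (G ⧸ (N : Subgroup G))) := by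
    have h1 : (Subgroup.zpowers γbar : Set (G ⧸ (N : Subgroup G))) =
        QuotientGroup.mk' (N : Subgroup G) '' (Subgroup.zpowers γ : Set G) := by
      rw [← Subgroup.coe_map, MonoidHom.map_zpowers, QuotientGroup.mk'_apply]
    rw [h1]
    exact (QuotientGroup.mk'_surjective (N : Subgroup G)).denseRange.dense_image
      QuotientGroup.continuous_mk hγ
  have htop : ∀ q : G ⧸ (N : Subgroup G), q ∈ Subgroup.zpowers γbar := fun q => by
    have hq : q ∈ closure (Subgroup.zpowers γbar : Set (G ⧸ (N : Subgroup G))) := hdenseQ q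
    rwa [(isClosed_discrete _).closure_eq] at hq
  have horder : orderOf γbar = (N : Subgroup G).index := by
    rw [orderOf_eq_card_of_forall_mem_zpowers htop, Subgroup.index]
  -- `k ↦ γ̄ ^ k` is onto `Q`, and its kernel kills `x`
  set e : Multiplicative ℤ →* G ⧸ (N : Subgroup G) := zpowersHom _ γbar with he
  have hesurj : Surjective e := fun q => by
    obtain ⟨k, hk⟩ := Subgroup.mem_zpowers_iff.mp (htop q)
    exact ⟨Multiplicative.ofAdd k, by rw [he, zpowersHom_apply, toAdd_ofAdd, hk]⟩
  set ψ₀ : Multiplicative ℤ →* Multiplicative X := (zmultiplesHom X x).toMultiplicative with hψ₀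
  have hker : e.ker ≤ ψ₀.ker := fun k hk => by
    rw [MonoidHom.mem_ker] at hk ⊢
    rw [he, zpowersHom_apply, ← orderOf_dvd_iff_zpow_eq_one, horder] at hk
    have hk' : (addOrderOf x : ℤ) ∣ Multiplicative.toAdd k := (Int.natCast_dvd_natCast.mpr hdvd).trans hk
    rw [hψ₀, AddMonoidHom.toMultiplicative_apply_apply, zmultiplesHom_apply,
      (addOrderOf_dvd_iff_zsmul_eq_zero).mp hk']
    rfl
  set ψ : G ⧸ (N : Subgroup G) →* Multiplicative X := e.liftOfSurjective hesurj ⟨ψ₀, hker⟩ with hψ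
  have hψe : ∀ k, ψ (e k) = ψ₀ k := fun k => e.liftOfRightInverse_comp_apply _ _ ⟨ψ₀, hker⟩ k
  -- the continuous homomorphism `G → G/N → X`
  let χ : C(G, X) :=
    ⟨fun g => Multiplicative.toAdd (ψ (g : G ⧸ (N : Subgroup G))),
      continuous_of_discreteTopology.comp
        ((continuous_of_discreteTopology (f := ψ)).comp QuotientGroup.continuous_mk)⟩
  have hχ : ∀ a b : G, χ (a * b) = χ a + χ b := fun a b => by
    change Multiplicative.toAdd (ψ ((a * b : G) : G ⧸ (N : Subgroup G))) =
      Multiplicative.toAdd (ψ (a : G ⧸ (N : Subgroup G))) +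
        Multiplicative.toAdd (ψ (b : G ⧸ (N : Subgroup G)))
    rw [QuotientGroup.mk_mul, map_mul, toAdd_mul]
  refine ⟨⟨χ, fun a b => by rw [hχ, htriv]⟩, ?_⟩
  rw [contOneCocycles.evalₗ_apply]
  change Multiplicative.toAdd (ψ γbar) = x
  have h1 : γbar = e (Multiplicative.ofAdd (1 : ℤ)) := by
    rw [he, zpowersHom_apply, toAdd_ofAdd, zpow_one]
  rw [h1, hψe, hψ₀, AddMonoidHom.toMultiplicative_apply_apply, toAdd_ofAdd, toAdd_ofAdd,
    zmultiplesHom_apply, one_zsmul]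

variable {X} in
/-- **`Hom_cont(G, X) ⥲ X`, `φ ↦ φ(γ)`, for `G ≅ Ẑ` topologically generated by `γ` and `X` a
discrete torsion group with trivial action** — "`H¹(Ẑ, ℚ/ℤ) = Hom(Ẑ, ℚ/ℤ) → ℚ/ℤ`, `φ ↦ φ(F)`, is an
isomorphism".  Hypotheses on `G`: profinite, `γ^ℤ` dense, an open subgroup of every positive
index (the two fields of the abc-iut cell's `FundamentalExtension.IsFreeProcyclic`).
[cite: SerreLocalFields1979, XIII §3] -/
def contOneCocyclesEquivOfDenseZpowers [DiscreteTopology X]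
    (htriv : ∀ (g : G) (x : X), X.ρ g x = x) {γ : G}
    (hγ : Dense (Subgroup.zpowers γ : Set G))
    (hidx : ∀ n : ℕ, 0 < n → ∃ H : Subgroup G, IsOpen (H : Set G) ∧ H.index = n)
    (htors : ∀ x : X, IsOfFinAddOrder x) : contOneCocycles X ≃ₗ[R] X :=
  LinearEquiv.ofBijective (contOneCocycles.evalₗ X γ)
    ⟨contOneCocycles.evalₗ_injective_of_dense htriv hγ,
      fun x => contOneCocycles.exists_evalₗ_eq htriv hγ hidx x (htors x)⟩

variable {X} in
/-- `contOneCocyclesEquivOfDenseZpowers φ = φ(γ)`. [cite: SerreLocalFields1979, XIII §3] -/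
@[simp] theorem contOneCocyclesEquivOfDenseZpowers_apply [DiscreteTopology X]
    (htriv : ∀ (g : G) (x : X), X.ρ g x = x) {γ : G}
    (hγ : Dense (Subgroup.zpowers γ : Set G))
    (hidx : ∀ n : ℕ, 0 < n → ∃ H : Subgroup G, IsOpen (H : Set G) ∧ H.index = n)
    (htors : ∀ x : X, IsOfFinAddOrder x) (φ : contOneCocycles X) :
    contOneCocyclesEquivOfDenseZpowers htriv hγ hidx htors φ = φ.1 γ :=
  rfl

variable {X} in
/-- `((contOneCocyclesEquivOfDenseZpowers)⁻¹ x)(γ) = x`: the continuous homomorphism attached to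
`x` takes the value `x` at the generator. [cite: SerreLocalFields1979, XIII §3] -/
@[simp] theorem contOneCocyclesEquivOfDenseZpowers_symm_apply_apply [DiscreteTopology X]
    (htriv : ∀ (g : G) (x : X), X.ρ g x = x) {γ : G}
    (hγ : Dense (Subgroup.zpowers γ : Set G))
    (hidx : ∀ n : ℕ, 0 < n → ∃ H : Subgroup G, IsOpen (H : Set G) ∧ H.index = n)
    (htors : ∀ x : X, IsOfFinAddOrder x) (x : X) :
    ((contOneCocyclesEquivOfDenseZpowers htriv hγ hidx htors).symm x).1 γ = x :=
  (contOneCocyclesEquivOfDenseZpowers htriv hγ hidx htors).apply_symm_apply x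

end Eval

/-! ### §5 (continued) `H²(Ẑ, ℤ) ≅ ℚ/ℤ` -/

namespace IsSES

variable {G : Type u} [Group G] [TopologicalSpace G] [IsTopologicalGroup G] [CompactSpace G]
  [T2Space G] [TotallyDisconnectedSpace G]
variable {M₁ : Type u} [AddCommGroup M₁] [TopologicalSpace M₁] [DiscreteTopology M₁]
variable {M₂ : Type u} [AddCommGroup M₂] [TopologicalSpace M₂] [DiscreteTopology M₂]
variable {M₃ : Type u} [AddCommGroup M₃] [TopologicalSpace M₃] [DiscreteTopology M₃]
variable {ρ₁ : ContinuousRep G ℤ M₁} {ρ₂ : ContinuousRep G ℤ M₂} {ρ₃ : ContinuousRep G ℤ M₃}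
variable {f : ρ₁.toTopRep ⟶ ρ₂.toTopRep} {g : ρ₂.toTopRep ⟶ ρ₃.toTopRep}

/-- **`H²(G, M₁) ≅ M₃` for `G ≅ Ẑ`** — "`H²(Ẑ, ℤ) ⥲ H¹(Ẑ, ℚ/ℤ) = Hom(Ẑ, ℚ/ℤ) → ℚ/ℤ`, `φ ↦ φ(F)`":
for a short exact sequence `0 → M₁ → M₂ → M₃ → 0` of discrete modules over a profinite group `G`
with `M₂` uniquely divisible, `M₃` torsion with trivial action, `γ ∈ G` generating a dense cyclic
subgroup and `G` having an open subgroup of every positive index, the composite of the inverse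
Bockstein isomorphism, `H¹ = Hom_cont`, and evaluation at `γ`.
[cite: SerreLocalFields1979, XIII §3] -/
def H2EquivOfDenseZpowers (h : IsSES f g)
    (hdiv : ∀ n : ℕ, 0 < n → Bijective fun m : M₂ => (n : ℤ) • m)
    (htriv : ∀ (σ : G) (x : M₃), ρ₃ σ x = x) {γ : G}
    (hγ : Dense (Subgroup.zpowers γ : Set G))
    (hidx : ∀ n : ℕ, 0 < n → ∃ H : Subgroup G, IsOpen (H : Set G) ∧ H.index = n)
    (htors : ∀ x : M₃, IsOfFinAddOrder x) :
    continuousCohomology 2 ρ₁.toTopRep ≃ₗ[ℤ] M₃ :=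
  h.H2EquivContOneCocycles hdiv htriv ≪≫ₗ
    contOneCocyclesEquivOfDenseZpowers (X := ρ₃.toTopRep) htriv hγ hidx htors

/-- `H2EquivOfDenseZpowers z = (H2EquivContOneCocycles z)(γ)`: the invariant of a class is the
value at `γ` of the continuous homomorphism whose Bockstein it is. [cite: SerreLocalFields1979, XIII §3] -/
theorem H2EquivOfDenseZpowers_apply (h : IsSES f g)
    (hdiv : ∀ n : ℕ, 0 < n → Bijective fun m : M₂ => (n : ℤ) • m)
    (htriv : ∀ (σ : G) (x : M₃), ρ₃ σ x = x) {γ : G}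
    (hγ : Dense (Subgroup.zpowers γ : Set G))
    (hidx : ∀ n : ℕ, 0 < n → ∃ H : Subgroup G, IsOpen (H : Set G) ∧ H.index = n)
    (htors : ∀ x : M₃, IsOfFinAddOrder x) (z : continuousCohomology 2 ρ₁.toTopRep) :
    h.H2EquivOfDenseZpowers hdiv htriv hγ hidx htors z =
      (h.H2EquivContOneCocycles hdiv htriv z).1 γ :=
  rfl

/-- **Characterisation of the inverse**: `(H2EquivOfDenseZpowers)⁻¹ x = δ₁ [φ]` for EVERY
continuous homomorphism `φ : G → M₃` with `φ(γ) = x` (such a `φ` is unique). In the classical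
case: the class of `H²(Ẑ, ℤ)` with invariant `x ∈ ℚ/ℤ` is the Bockstein of the character
`F ↦ x`. [cite: SerreLocalFields1979, XIII §3] -/
theorem H2EquivOfDenseZpowers_symm_apply_eq (h : IsSES f g)
    (hdiv : ∀ n : ℕ, 0 < n → Bijective fun m : M₂ => (n : ℤ) • m)
    (htriv : ∀ (σ : G) (x : M₃), ρ₃ σ x = x) {γ : G}
    (hγ : Dense (Subgroup.zpowers γ : Set G))
    (hidx : ∀ n : ℕ, 0 < n → ∃ H : Subgroup G, IsOpen (H : Set G) ∧ H.index = n)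
    (htors : ∀ x : M₃, IsOfFinAddOrder x) (x : M₃) (φ : contOneCocycles ρ₃.toTopRep)
    (hφ : φ.1 γ = x) :
    (h.H2EquivOfDenseZpowers hdiv htriv hγ hidx htors).symm x = h.δ₁ (oneCocycleClass _ φ) := by
  have hφ' : (contOneCocyclesEquivOfDenseZpowers (X := ρ₃.toTopRep) htriv hγ hidx htors).symm x = φ := by
    rw [LinearEquiv.symm_apply_eq, contOneCocyclesEquivOfDenseZpowers_apply, hφ]
  change (h.H2EquivContOneCocycles hdiv htriv).symm
    ((contOneCocyclesEquivOfDenseZpowers (X := ρ₃.toTopRep) htriv hγ hidx htors).symm x) = _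
  rw [hφ', H2EquivContOneCocycles_symm_apply]

end IsSES

/-! ### §6 Short exact sequences of trivial discrete modules from exact triples of groups -/

section Trivial

variable (G : Type u) [Group G] [TopologicalSpace G]
variable {M₁ : Type u} [AddCommGroup M₁] [TopologicalSpace M₁] [DiscreteTopology M₁]
variable {M₂ : Type u} [AddCommGroup M₂] [TopologicalSpace M₂] [DiscreteTopology M₂]
variable {M₃ : Type u} [AddCommGroup M₃] [TopologicalSpace M₃] [DiscreteTopology M₃]

/-- An additive homomorphism of discrete groups as a morphism of the TRIVIAL topological
`G`-representations (plumbing for `IsSES.ofTrivial`). [cite: SerreLocalFields1979, XIII §1] -/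
def trivialHom (φ : M₁ →+ M₂) :
    (ContinuousRep.trivial G ℤ M₁).toTopRep ⟶ (ContinuousRep.trivial G ℤ M₂).toTopRep :=
  TopRep.ofHom ⟨⟨φ.toIntLinearMap, continuous_of_discreteTopology⟩, fun _ => rfl⟩

/-- Unfolding `trivialHom`. [cite: SerreLocalFields1979, XIII §1] -/
@[simp] theorem trivialHom_hom_apply (φ : M₁ →+ M₂) (m : M₁) : (trivialHom G φ).hom m = φ m := rfl

/-- **The short exact sequence `0 → M₁ → M₂ → M₃ → 0` of TRIVIAL discrete `G`-modules** attached to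
an exact triple `M₁ ↪ M₂ ↠ M₃` of additive homomorphisms (e.g. `ℤ ⊆ ℚ ↠ ℚ/ℤ` in any discrete
model); feed it to `IsSES.δ₁Equiv` / `IsSES.H2EquivContOneCocycles` / `IsSES.H2EquivOfDenseZpowers`.
[cite: SerreLocalFields1979, XIII §1] -/
theorem IsSES.ofTrivial (i : M₁ →+ M₂) (q : M₂ →+ M₃) (hi : Injective i) (hq : Surjective q)
    (hiq : ∀ y : M₂, q y = 0 ↔ y ∈ i.range) :
    IsSES (trivialHom G i) (trivialHom G q) where
  comp_eq_zero := by
    ext m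
    change q (i m) = 0
    exact (hiq (i m)).mpr ⟨m, rfl⟩
  injective := hi
  exact_mid y hy := by
    obtain ⟨x, hx⟩ := (hiq y).mp hy
    exact ⟨x, hx⟩
  surjective := hq

end Trivial

end Literature.NumberTheory.GaloisRepresentations

end
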